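/-
Copyright (c) 2026 the pub-hodgecm-mathlib formalisation cell (harness21).  Prover seat hodgecm-mathlib-K2Liu-p10 (g5), Track B «K2-LIT»,
#184♮ = hLiu418 = `stmt-HodgeConjecture-24832`; (σ) endgame organ, the `hne` transport letter, FILE T2b: the (θ1)–(θ4) letters of K2Liu-p09's (N2)
`K2LiuA7ValueWitnessTransport` for `θ := Ad d_a`, and the bridge `Ad d_a = localCongr DA` to K2Liu-p07's rational similitude.
-/
import Summits.HodgeConjecture.HodgeConjecture.Theorems.K2LiuDeltaSimilitudeIntertwining   -- ★∕📤 T2 p861538 (`leviScalar`, `adUnip`, `localIntertwining_comp_adDeltaSimil_eq_smul`)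
import Summits.HodgeConjecture.HodgeConjecture.Theorems.K2LiuFlatSiegelFamilies            -- ★ `isQRationalRegularAt_localSiegelCharacter` (brings ★ `K2LiuQRationalDefs`)
import Summits.HodgeConjecture.HodgeConjecture.Theorems.K2LiuLocalSWSimilitudeAlgebra       -- ★ K2Liu-p07 (`matA_localCongr_dA`; brings ★ `UnitaryGroup.localCongr`)
import HarnessLib

/-!
# Crux `HLiu418`, (σ) endgame, `hne` transport letter, FILE T2b: THE LETTERS (θ1)–(θ4) FOR `θ := Ad d_a`, AND `Ad d_a = localCongr DA`

Cell `hodgecm-mathlib`, crux item hLiu418 = `stmt-HodgeConjecture-24832`, route of record `HCCMUnconditional`; squad K2 ∕ K2Liu, prover K2Liu-p10 (g5); organ lead K2Liu-p09 (g7)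
(15:37:46Z ∕ 15:40:51Z: ★∕📤 (N2) `K2LiuA7ValueWitnessTransport` is hypothesis-first in `θ : H_v ≃ₜ* H_v` with laws (θ1) `hθP`, (θ2) `hθS`, (θ3) `hθsm`, (θ4) `cθ hcθ hcθ0 hθM`).
THEOREMS ONLY; lane `--supports stmt-HodgeConjecture-24832 --as helper`.  ★ K2Lit generic currency `(F E c hcδ hδ hd v n hT₀ hJD)`.

* §1 the letters at `θ := adDeltaSimil … a` (★ T1 p861412): **`hθP_adDeltaSimil`** (`IsSiegelDelta p ↔ IsSiegelDelta (θ p)`), **`hθS_adDeltaSimil`**, **`hθsm_adDeltaSimil`** (restated in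
  (N2)'s orientation), and (θ4) with the EXPLICIT constant `cθ s := localSiegelCharacter χ_v s (m_{a⁻¹}) · c_a`, `c_a = haarScalarFactor ((Ad d_a)_* νN) νN`:
  **`hcθ_adDeltaSimil`** (`q_v^{-s}`-rational, regular at every `s₀`; ★ `isQRationalRegularAt_localSiegelCharacter`), **`hcθ0_adDeltaSimil`** (`≠ 0` at every `s`),
  **`hθM_adDeltaSimil`** (`M_v(g ∘ θ)(h) = cθ s · M_v(g)(θ h)` for Siegel sections; ★∕📤 T2).
* §2 **`adDeltaSimil_eq_localCongr_dA`**: for a RATIONAL `a ∈ (L⁺)ˣ`, `Ad d_{a_v} = localCongr DA` (K2Liu-p07's ★ `K2LiuLocalSWSimilitudeAlgebra` similitude of `J^𝔻`, the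
  `θ` of ★ (iii) `exists_mover_localSWImage_map_localCongr_dA`) — both have the same `matA` formula (★ `matA_injective`).

HONEST LABEL: HC_CM is proved only modulo the 7 printed citations (2 remaining named inputs: hLiu418 = stmt-HodgeConjecture-24832, h413 = stmt-HodgeConjecture-24833)
until rung 0 closes; helper, closes no item.
References: [Casselman1980] §3; [HarrisKudlaSweet1996] §1 (1.15), §6 (6.14); [KudlaSweet1997] §1; [Kudla1994] §3; [PlatonovRapinchuk1994] §2.3.
-/

set_option autoImplicit false
set_option linter.dupNamespace false -- the mandated namespace repeats `HodgeConjecture.HodgeConjecture`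

noncomputable section

open scoped Matrix NNReal ENNReal
open NumberField IsDedekindDomain Matrix Topology MeasureTheory
open Literature.NumberTheory.Automorphic Literature.NumberTheory.Automorphic.UnitaryGroup
open Literature.NumberTheory.GaloisRepresentations Literature.NumberTheory.GaloisRepresentations.IsNonarchimedeanLocalField
open Literature.NumberTheory.GelbartRogawski1991
open Literature.NumberTheory.GelbartRogawski1991.UnitaryDualPair
open Literature.NumberTheory.GelbartRogawski1991.UnitaryDualPair.LocalSplitting
open Literature.NumberTheory.GelbartRogawski1991.AdaptedBlocks
open Literature.NumberTheory.K2Lit.LocalSiegelDoubled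
open Summit.HodgeConjecture.HodgeConjecture.Cruxes.HLiu418.K2LiuQRationalDefs
open Summit.HodgeConjecture.HodgeConjecture.Cruxes.HLiu418.K2LiuFlatSiegelFamilies
open Summit.HodgeConjecture.HodgeConjecture.Cruxes.HLiu418.K2LiuDeltaSimilitudeGroup
open Summit.HodgeConjecture.HodgeConjecture.Cruxes.HLiu418.K2LiuDeltaSimilitudeIntertwining
open Summit.HodgeConjecture.HodgeConjecture.Cruxes.HLiu418.K2LiuLocalSWSimilitudeAlgebra

namespace Summit.HodgeConjecture.HodgeConjecture.Cruxes.HLiu418.K2LiuDeltaSimilitudeTheta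

variable (F : Type) [Field F] [NumberField F] (E : Type) [Field E] [NumberField E] [Algebra F E]
  [Algebra.IsQuadraticExtension F E] (c : E ≃ₐ[F] E)
  {δ : E} (hcδ : c δ = -δ) (hδ : δ ≠ 0) {d : F} (hd : δ * δ = algebraMap F E d)
  (v : HeightOneSpectrum (𝓞 F)) (n : ℕ) {T₀ : Matrix (Fin n) (Fin n) F} (hT₀ : T₀.IsSymm)
  {JD : Matrix (Fin (n + n)) (Fin (n + n)) E} (hJD : JD = (gramD F n T₀).map (algebraMap F E))

/-! ## §1 The letters (θ1)–(θ4) of (N2) for `θ := Ad d_a` -/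

section Theta

variable (χv : ∀ w : PlacesOver E v, (w.1.adicCompletion E)ˣ →* ℂˣ) (a : (v.adicCompletion F)ˣ)

include hcδ hδ hd hT₀ in
/-- **(θ1) `hθP`**: `IsSiegelDelta p ↔ IsSiegelDelta (Ad d_a p)`. [cite: Kudla1994, §3] -/
theorem hθP_adDeltaSimil (p : UnitaryGroup.localPi E c (n + n) JD v) :
    IsSiegelDelta F E c hcδ hδ hd v n hT₀ hJD p ↔ IsSiegelDelta F E c hcδ hδ hd v n hT₀ hJD (adDeltaSimil F E c v n hJD a p) :=
  (isSiegelDelta_adDeltaSimil_iff F E c hcδ hδ hd v n hT₀ hJD a p).symm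

include hcδ hδ hd hT₀ in
/-- **(θ2) `hθS`**: Siegel sections of `I_v(s, χ_v)` pull back along `Ad d_a`. [cite: HarrisKudlaSweet1996, §1 (1.15)] -/
theorem hθS_adDeltaSimil (s : ℂ) (g : UnitaryGroup.localPi E c (n + n) JD v → ℂ) (hg : IsLocalSiegelSection F E c hcδ hδ hd v n hT₀ hJD χv s g) :
    IsLocalSiegelSection F E c hcδ hδ hd v n hT₀ hJD χv s (g ∘ adDeltaSimil F E c v n hJD a) :=
  isLocalSiegelSection_comp_adDeltaSimil F E c hcδ hδ hd v n hT₀ hJD a χv s hg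

omit [Algebra.IsQuadraticExtension F E] in
include hJD in
/-- **(θ3) `hθsm`**: smooth functions pull back along `Ad d_a`. [cite: BernsteinZelevinsky1976, §1] -/
theorem hθsm_adDeltaSimil (g : UnitaryGroup.localPi E c (n + n) JD v → ℂ) (hg : IsSmooth F E c v n g) :
    IsSmooth F E c v n (g ∘ adDeltaSimil F E c v n hJD a) :=
  isSmooth_comp_adDeltaSimil F E c v n hJD a hg

variable [MeasurableSpace ↥(unipDeltaLocal F E c v n (JD := JD))] [BorelSpace ↥(unipDeltaLocal F E c v n (JD := JD))]
  (νN : Measure ↥(unipDeltaLocal F E c v n (JD := JD)))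
  [LocallyCompactSpace ↥(unipDeltaLocal F E c v n (JD := JD))] [SecondCountableTopology ↥(unipDeltaLocal F E c v n (JD := JD))] [νN.IsHaarMeasure]

omit [LocallyCompactSpace ↥(unipDeltaLocal F E c v n (JD := JD))] [SecondCountableTopology ↥(unipDeltaLocal F E c v n (JD := JD))] in
include hcδ hδ hd hT₀ in
/-- **(θ4) `hcθ`**: the constant `cθ s := localSiegelCharacter χ_v s (m_{a⁻¹}) · c_a` is a `q_v^{-s}`-rational function, regular at every `s₀`.
[cite: KudlaSweet1997, §1] [cite: HarrisKudlaSweet1996, §1 (1.15)] -/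
theorem hcθ_adDeltaSimil (s₀ : ℂ) :
    IsQRationalRegularAt (residueFieldCard (v.adicCompletion F)) s₀ fun s =>
      localSiegelCharacter F E c v n χv s (leviScalar F E c v n hJD a⁻¹) *
        (((Measure.haarScalarFactor (Measure.map (adUnip F E c v n hJD a) νN) νN : ℝ≥0) : ℝ) : ℂ) :=
  (isQRationalRegularAt_localSiegelCharacter F E c hcδ hδ hd v n hT₀ hJD χv (isSiegelDelta_leviScalar F E c hcδ hδ hd v n hT₀ hJD a⁻¹) s₀).mul
    (isQRationalRegularAt_const _ _ _)

omit [LocallyCompactSpace ↥(unipDeltaLocal F E c v n (JD := JD))] [SecondCountableTopology ↥(unipDeltaLocal F E c v n (JD := JD))] in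
include hcδ hδ hd hT₀ in
/-- **(θ4) `hcθ0`**: `cθ s ≠ 0` for every `s` (a Siegel character value times a positive Haar constant). [cite: HarrisKudlaSweet1996, §1 (1.15)] [cite: WeilBNT1967, Ch. II §4] -/
theorem hcθ0_adDeltaSimil (s : ℂ) :
    localSiegelCharacter F E c v n χv s (leviScalar F E c v n hJD a⁻¹) *
        (((Measure.haarScalarFactor (Measure.map (adUnip F E c v n hJD a) νN) νN : ℝ≥0) : ℝ) : ℂ) ≠ 0 :=
  mul_ne_zero (localSiegelCharacter_ne_zero_of_isSiegelDelta F E c hcδ hδ hd v n hT₀ hJD χv s (isSiegelDelta_leviScalar F E c hcδ hδ hd v n hT₀ hJD a⁻¹))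
    (Complex.ofReal_ne_zero.2 (NNReal.coe_ne_zero.2 (haarScalarFactor_adUnip_pos F E c v n hJD νN a).ne'))

include hcδ hδ hd hT₀ in
/-- **(θ4) `hθM`**: `M_v(g ∘ Ad d_a)(h) = cθ s · M_v(g)(Ad d_a h)` for every Siegel section `g ∈ I_v(s, χ_v)` (smoothness and `1 < re s` are not needed).
[cite: Casselman1980, §3] [cite: HarrisKudlaSweet1996, §6 (6.14)] -/
theorem hθM_adDeltaSimil (g : UnitaryGroup.localPi E c (n + n) JD v → ℂ) (s : ℂ) (hg : IsLocalSiegelSection F E c hcδ hδ hd v n hT₀ hJD χv s g)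
    (h : UnitaryGroup.localPi E c (n + n) JD v) :
    localIntertwining F E c v n hJD νN (g ∘ adDeltaSimil F E c v n hJD a) h =
      (localSiegelCharacter F E c v n χv s (leviScalar F E c v n hJD a⁻¹) *
          (((Measure.haarScalarFactor (Measure.map (adUnip F E c v n hJD a) νN) νN : ℝ≥0) : ℝ) : ℂ)) *
        localIntertwining F E c v n hJD νN g (adDeltaSimil F E c v n hJD a h) := by
  rw [localIntertwining_comp_adDeltaSimil_eq_smul F E c hcδ hδ hd v n hT₀ hJD νN χv s hg a h, NNReal.smul_def, Complex.real_smul, mul_assoc]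

include hcδ hδ hd hT₀ in
/-- (θ4) in (N2)'s exact binder shape (`IsSmooth` and `1 < re s` accepted and unused). [cite: Casselman1980, §3] -/
theorem hθM_adDeltaSimil' (g : UnitaryGroup.localPi E c (n + n) JD v → ℂ) (s : ℂ) (hg : IsLocalSiegelSection F E c hcδ hδ hd v n hT₀ hJD χv s g)
    (_hsm : IsSmooth F E c v n g) (_hs : 1 < s.re) (h : UnitaryGroup.localPi E c (n + n) JD v) :
    localIntertwining F E c v n hJD νN (g ∘ adDeltaSimil F E c v n hJD a) h =
      (localSiegelCharacter F E c v n χv s (leviScalar F E c v n hJD a⁻¹) *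
          (((Measure.haarScalarFactor (Measure.map (adUnip F E c v n hJD a) νN) νN : ℝ≥0) : ℝ) : ℂ)) *
        localIntertwining F E c v n hJD νN g (adDeltaSimil F E c v n hJD a h) :=
  hθM_adDeltaSimil F E c hcδ hδ hd v n hT₀ hJD χv a νN g s hg h

end Theta

/-! ## §2 The bridge to K2Liu-p07's rational similitude: `Ad d_{a_v} = localCongr DA` -/

section Bridge

variable (a : Fˣ) {D₀ : GL (Fin (n + n)) F}
  (hD₀ : (D₀ : Matrix (Fin (n + n)) (Fin (n + n)) F) =
    Matrix.reindex (e₂ n) (e₂ n) (cayR F (Fin n) * Matrix.fromBlocks 1 0 0 ((a : F) • (1 : Matrix (Fin n) (Fin n) F)) * cayRinv F (Fin n)))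
  {DA : GL (Fin (n + n)) E} (hDA : DA = Matrix.GeneralLinearGroup.map (algebraMap F E) D₀)
  {b : E} (hb : b ≠ 0) (hDAJ : Literature.NumberTheory.Automorphic.formCongr (c : E →+* E) DA (b • JD) = JD)

omit [Algebra.IsQuadraticExtension F E] in
include hD₀ hDA hJD in
/-- **`Ad d_{a_v} = localCongr DA` ON `H_v`** for a rational `a ∈ (L⁺)ˣ` (`a_v = ι_v a ∈ (L⁺_v)ˣ`): the two conjugations have the same adapted-frame matrix
`S_{a_v} · matA p · S_{a_v⁻¹}` (★ T1 `matA_adDeltaSimil`, ★ K2Liu-p07 `matA_localCongr_dA`, ★ `matA_injective`). [cite: PlatonovRapinchuk1994, §2.3] [cite: Kudla1994, §3] -/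
theorem adDeltaSimil_eq_localCongr_dA (p : UnitaryGroup.localPi E c (n + n) JD v) :
    adDeltaSimil F E c v n hJD (Units.map (algebraMap F (v.adicCompletion F) : F →* v.adicCompletion F) a) p = localCongr E c DA hb hDAJ v p := by
  apply matA_injective F E c v n
  rw [matA_adDeltaSimil, matA_localCongr_dA F E c v n a hD₀ hDA hb hDAJ, ← map_inv]
  rfl

end Bridge

end Summit.HodgeConjecture.HodgeConjecture.Cruxes.HLiu418.K2LiuDeltaSimilitudeTheta

end
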